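import Summits.QuantumFields.BalabanUV.Beta.D1BFx.GhostStencilDivergence

/-!
# `BalabanUV.Beta.D1BFx.GhostStencilRooted` — road «BF-x» for binder row D1, sub-leaf T6-ρ (part A): THE ROOT-PARAMETRIC FIRST
# AVERAGING JET `qJetAt ρ` / `qAntiAt ρ` / `SghAt ρ` — T6 v1's colour-stripped `Q′(U)`-jet with an1's axial contour rooted at
# `n•y + ρ` instead of the base corner `n•y` (T6 v1 = the `ρ = 0` instance BY `rfl`), with the same sockets for every in-block root

HONEST DEPENDENCY (page 1, mandatory): continuum YM on T⁴ ⇐ BetaPertH ∧ nine spine estimates (0/9 proved); BetaPertH ⇐ (D1) ∧ (D4) ∧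
CAP+tail; G-an2-4 gates asym, D1 and NE2/3/4.  HONEST FRAMING (cell contract, verbatim): «discharging `BetaPertH` makes Bałaban's UV
stability UNCONDITIONAL — a real constructive-QFT result; it is NOT the continuum limit and NOT the Clay problem.»  THIS FILE DISCHARGES
NOTHING of D1 / BetaPertH: it types OBJECTS (definitions asserting nothing) and proves [folklore] finite bookkeeping about them; 0 binders
of the hR root are touched; no `def … : Prop`, no citation, no printed statement as hypothesis.
ABSOLUTE RULE (cell charter, verbatim): «No internally-minted statement may enter as a cited fact. Every hypothesis is either
kernel-proved in this package or a verbatim quotation of a PUBLISHED theorem with page reference. The manuscript(s) under audit are NOT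
citable for their own disputed steps — they are the thing under adjudication; programme-internal (2001/route/tribunal) claims are never
citable.»

WHY (GAPS § C-d1leaf01-g3-1, repair (R-a); β-lead RULING (R32-1) / an5 X-an5-17 for the spine: «the landed base-rooted objects are the
ρ = 0 instances», centre root for odd side).  Part 3 of sub-leaf A4-leg-PARITY-gh (`GhostStencilReflectionQ.qAnti_no_pointInversion_law`)
showed that T6 v1's CORNER-rooted `qAnti` cannot satisfy the parity socket `hSr` of node R5's ghost END; the root is the only obstruction
(the current `ghCur` and the contact `ghX` pass with `(invLeg n, cInv n, σ ≡ −1)`).  This part types the root-parametric family and its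
root-INDEPENDENT sockets; part B (`GhostStencilRootedReflection`) proves the inversion law at the centred root for odd `n`.
* §1 [our objects] `qJetAt ρ n κ′ u y x := [blk x = y ∧ blk u = y]·(n⁴)⁻¹·γ(κ′, u; n•y + ρ, x)`, `qAntiAt ρ n κ′ u x z := qJetAt(blk x, z) −
  qJetAt(blk z, x)`, `SghAt ρ n cK cQ κ′ u := cK·ghCur κ′ u + cQ·qAntiAt ρ n κ′ u`; bridges `qJetAt_zero = qJet`, `qAntiAt_zero = qAnti`,
  `SghAt_zero = Sgh` (T6 v1 untouched).
* §2 [folklore] IN-BLOCK ROOTS (`0 ≤ ρ_i < n`): the root `n•y + ρ` lies in block `y` (`blk_root`); GUARD REDUNDANCY `qJetAt_eq_unguarded`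
  (part 5a's range lemma); size `|γ| ≤ 4n` on the block (`axial_length`), `|qJetAt| ≤ 4/n³`, `biLoc_qAntiAt … u u ((8/n³)e^{8δ}) (δ/n)`,
  `biLoc_SghAt`.
* §3 [folklore] root-independent structure: antisymmetry, block-translation covariance `qJetAt_translate` / `qAntiAt_translate` /
  `SghAt_translate` (an1's `gammaCoeff_translate`), `SghAt_translate_block` (leaf-04's binder shape).
NOT HERE: the inversion law (part B), the `Q′(U)` second jets, anything printed; which root Bałaban's averaging uses is the owner's
identification (B12 p. 251 «a center at y», `L` odd — locator only).  Unit `b2b-balaban-beta-d1-formalise-leaf-01` (gen 3).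
-/

noncomputable section

namespace Summit.QuantumFields.BalabanUV.Beta.D1BFx.GhostStencilRooted

open Finset
open scoped BigOperators
open Literature.MathematicalPhysics.QuantumFieldTheory.Balaban1983to89
open Literature.MathematicalPhysics.QuantumFieldTheory.Balaban1983to89.Beta
open B12Sec2to5 (l1 l1_nonneg)
open B6QGQLower276 (blk side loc side_mul_blk_add_loc loc_nonneg loc_lt)
open ExpKernelCalculus (Site MKer BiLoc shiftK)
open AffineAveraging (Form1 unitVec unitVec_apply)
open AveragingContours (axial axial_length)
open Summit.QuantumFields.BalabanUV.Beta.D1BFx.GhostLeg (side_pred blk_pred_apply)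
open Summit.QuantumFields.BalabanUV.Beta.D1BFx.GhostStencil (bondForm gammaCoeff qJet qAnti qAnti_apply Sgh Sgh_apply ghCur ghCur_apply
  ghCur_antisymm ghCur_translate biLoc_ghCur abs_letter_le abs_sum_le_length mem_block_of_blk_eq l1_sub_le_of_blk_eq blk_translate'
  gammaCoeff_translate)
open Summit.QuantumFields.BalabanUV.Beta.D1BFx.GhostStencilDivergence (mem_axial_between blk_of_between)

/-! ## §1 The objects and the `ρ = 0` bridges -/

/-- [our object] **THE ROOT-PARAMETRIC FIRST AVERAGING JET**: `qJetAt ρ n κ′ u y x := n⁻⁴·[x ∈ B_n(y)]·[u ∈ B_n(y)]·γ(κ′, u; n•y + ρ, x)` —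
T6 v1's `qJet` with the axial contour rooted at `n•y + ρ` (ρ = 0: the base corner; ρ = ((n−1)/2)·𝟙, `n` odd: the block centre).
A definition; asserts nothing. -/
def qJetAt (ρ : Site 4) (n : ℕ) (κ' : Fin 4) (u y x : Site 4) : ℝ :=
  if blk (n - 1) x = y ∧ blk (n - 1) u = y then ((n : ℝ) ^ 4)⁻¹ * gammaCoeff κ' u ((n : ℤ) • y + ρ) x else 0

/-- [our object] **THE ROOT-PARAMETRIC STRIPPED JET OF `Q′(U)*Q′(U)`**: `qAntiAt ρ n κ′ u x z := qJetAt ρ (blk x) z − qJetAt ρ (blk z) x`. -/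
def qAntiAt (ρ : Site 4) (n : ℕ) (κ' : Fin 4) (u : Site 4) : MKer 4 Unit := fun x z _ _ =>
  qJetAt ρ n κ' u (blk (n - 1) x) z - qJetAt ρ n κ' u (blk (n - 1) z) x

/-- [our object] **THE ROOT-PARAMETRIC FIRST-ORDER GHOST STENCIL** `SghAt ρ n cK cQ κ′ u := cK·ghCur κ′ u + cQ·qAntiAt ρ n κ′ u`. -/
def SghAt (ρ : Site 4) (n : ℕ) (cK cQ : ℝ) (κ' : Fin 4) (u : Site 4) : MKer 4 Unit := fun x z a b =>
  cK * ghCur κ' u x z a b + cQ * qAntiAt ρ n κ' u x z a b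

variable (ρ : Site 4) (n : ℕ) (κ' : Fin 4) (u : Site 4)

/-- [our object] Unfolding `qAntiAt`. -/
theorem qAntiAt_apply (x z : Site 4) (a b : Unit) :
    qAntiAt ρ n κ' u x z a b = qJetAt ρ n κ' u (blk (n - 1) x) z - qJetAt ρ n κ' u (blk (n - 1) z) x := rfl

/-- [our object] Unfolding `SghAt`. -/
theorem SghAt_apply (cK cQ : ℝ) (x z : Site 4) (a b : Unit) :
    SghAt ρ n cK cQ κ' u x z a b = cK * ghCur κ' u x z a b + cQ * qAntiAt ρ n κ' u x z a b := rfl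

/-- [folklore] **BRIDGE**: T6 v1's jet is the base-corner instance, `qJetAt 0 = qJet`. -/
theorem qJetAt_zero : qJetAt 0 = qJet := by
  funext n κ u y x
  unfold qJetAt qJet
  rw [add_zero]

/-- [folklore] **BRIDGE**: `qAntiAt 0 = qAnti`. -/
theorem qAntiAt_zero : qAntiAt 0 = qAnti := by
  funext n κ u x z a b
  rw [qAntiAt_apply, qAnti_apply, qJetAt_zero]

/-- [folklore] **BRIDGE**: `SghAt 0 = Sgh`. -/
theorem SghAt_zero : SghAt 0 = Sgh := by
  funext n cK cQ κ u x z a b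
  rw [SghAt_apply, Sgh_apply, qAntiAt_zero]

/-- [folklore] Off the guard the jet vanishes. -/
theorem qJetAt_eq_zero {y x : Site 4} (h : ¬(blk (n - 1) x = y ∧ blk (n - 1) u = y)) : qJetAt ρ n κ' u y x = 0 := by
  unfold qJetAt; rw [if_neg h]

/-- [folklore] `qAntiAt` is antisymmetric. -/
theorem qAntiAt_antisymm (x z : Site 4) (a b : Unit) : qAntiAt ρ n κ' u z x b a = -qAntiAt ρ n κ' u x z a b := by
  simp only [qAntiAt_apply]; ring

/-- [folklore] `SghAt` is antisymmetric. -/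
theorem SghAt_antisymm (cK cQ : ℝ) (x z : Site 4) (a b : Unit) :
    SghAt ρ n cK cQ κ' u z x b a = -SghAt ρ n cK cQ κ' u x z a b := by
  rw [SghAt_apply, SghAt_apply, ghCur_antisymm, qAntiAt_antisymm]; ring

/-! ## §2 In-block roots: guard redundancy and the localisation sockets -/

variable [NeZero n]

/-- [folklore] **AN IN-BLOCK ROOT** (`0 ≤ ρ_i < n`): `n•y + ρ` lies in block `y`. -/
theorem blk_root {ρ : Site 4} (hρ : ∀ i : Fin 4, 0 ≤ ρ i ∧ ρ i < n) (y : Site 4) : blk (n - 1) ((n : ℤ) • y + ρ) = y := by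
  have h0 : blk (n - 1) ρ = 0 := by
    funext i
    rw [blk_pred_apply, Pi.zero_apply]
    exact Int.ediv_eq_zero_of_lt (hρ i).1 (hρ i).2
  rw [add_comm, blk_translate', h0, zero_add]

/-- [folklore] For an in-block root, a bond outside block `Y` is never on the contour `Γ_{n•Y + ρ, w}` of a point `w` of block `Y`. -/
theorem gammaCoeff_root_eq_zero_of_blk_ne {ρ : Site 4} (hρ : ∀ i : Fin 4, 0 ≤ ρ i ∧ ρ i < n) {v w Y : Site 4}
    (hw : blk (n - 1) w = Y) (hv : blk (n - 1) v ≠ Y) : gammaCoeff κ' v ((n : ℤ) • Y + ρ) w = 0 := by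
  unfold gammaCoeff
  refine List.sum_eq_zero fun a ha => ?_
  obtain ⟨κ₁, v₁, hav, hbetween⟩ := mem_axial_between ha
  have hv₁ : blk (n - 1) v₁ = Y := blk_of_between n (blk_root n hρ Y) hw hbetween
  have hb : bondForm κ' v κ₁ v₁ = 0 := by
    unfold bondForm
    rw [if_neg]
    rintro ⟨-, h⟩
    exact hv (by rw [← h, hv₁])
  rcases hav with h | h
  · rw [h, hb]
  · rw [h, hb, neg_zero]

/-- [folklore] **GUARD REDUNDANCY** for in-block roots: `qJetAt ρ n κ v Y w = [blk w = Y]·(n⁴)⁻¹·γ(κ, v; n•Y + ρ, w)`. -/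
theorem qJetAt_eq_unguarded {ρ : Site 4} (hρ : ∀ i : Fin 4, 0 ≤ ρ i ∧ ρ i < n) (κ : Fin 4) (v Y w : Site 4) :
    qJetAt ρ n κ v Y w = if blk (n - 1) w = Y then ((n : ℝ) ^ 4)⁻¹ * gammaCoeff κ v ((n : ℤ) • Y + ρ) w else 0 := by
  unfold qJetAt
  by_cases hw : blk (n - 1) w = Y
  · by_cases hv : blk (n - 1) v = Y
    · rw [if_pos ⟨hw, hv⟩, if_pos hw]
    · rw [if_neg (fun h => hv h.2), if_pos hw, gammaCoeff_root_eq_zero_of_blk_ne n κ hρ hw hv, mul_zero]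
  · rw [if_neg (fun h => hw h.1), if_neg hw]

/-- [folklore] **SIZE OF THE ROOTED CONTOUR COEFFICIENT** inside the block: `|γ(κ′, u; n•y + ρ, x)| ≤ |Γ| ≤ 4(n−1) ≤ 4n` for `x` in block `y`
and an in-block root (`AveragingContours.axial_length`: the ℓ¹ distance of two points of one block). -/
theorem abs_gammaCoeff_root_le {ρ : Site 4} (hρ : ∀ i : Fin 4, 0 ≤ ρ i ∧ ρ i < n) {x y : Site 4} (h : blk (n - 1) x = y) :
    |gammaCoeff κ' u ((n : ℤ) • y + ρ) x| ≤ 4 * (n : ℝ) := by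
  have hx := mem_block_of_blk_eq n h
  have hlen : (axial (bondForm κ' u) ((n : ℤ) • y + ρ) x).length ≤ 4 * n := by
    rw [axial_length]
    calc ∑ i : Fin 4, (x i - ((n : ℤ) • y + ρ) i).natAbs ≤ ∑ _i : Fin 4, n := by
          refine Finset.sum_le_sum fun i _ => ?_
          have h1 := (hx i).1; have h2 := (hx i).2; have h3 := (hρ i).1; have h4 := (hρ i).2
          rw [Pi.add_apply]
          omega
      _ = 4 * n := by simp
  have h1 := abs_sum_le_length (axial (bondForm κ' u) ((n : ℤ) • y + ρ) x) (fun a ha => abs_letter_le κ' u ha)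
  unfold gammaCoeff
  calc |(axial (bondForm κ' u) ((n : ℤ) • y + ρ) x).sum| ≤ ((axial (bondForm κ' u) ((n : ℤ) • y + ρ) x).length : ℝ) := h1
    _ ≤ ((4 * n : ℕ) : ℝ) := by exact_mod_cast hlen
    _ = 4 * (n : ℝ) := by push_cast; ring

/-- [folklore] **SIZE OF THE ROOTED JET**: `|qJetAt ρ n κ′ u y x| ≤ 4/n³` (in-block root). -/
theorem abs_qJetAt_le {ρ : Site 4} (hρ : ∀ i : Fin 4, 0 ≤ ρ i ∧ ρ i < n) (y x : Site 4) : |qJetAt ρ n κ' u y x| ≤ 4 / (n : ℝ) ^ 3 := by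
  have hn : (0 : ℝ) < n := Nat.cast_pos.mpr (Nat.pos_of_ne_zero (NeZero.ne n))
  unfold qJetAt
  split_ifs with h
  · rw [abs_mul, abs_inv, abs_of_pos (pow_pos hn 4)]
    have h1 := abs_gammaCoeff_root_le n κ' u hρ h.1
    calc ((n : ℝ) ^ 4)⁻¹ * |gammaCoeff κ' u ((n : ℤ) • y + ρ) x| ≤ ((n : ℝ) ^ 4)⁻¹ * (4 * n) :=
          mul_le_mul_of_nonneg_left h1 (inv_nonneg.mpr (pow_pos hn 4).le)
      _ = 4 / (n : ℝ) ^ 3 := by field_simp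
  · rw [abs_zero]; positivity

/-- [folklore] **LOCALISATION SOCKET OF THE ROOTED AVERAGING JET** (in-block root; same constants as T6 v1's `biLoc_qAnti`):
`BiLoc (qAntiAt ρ n κ′ u) u u ((8/n³)·e^{8δ}) (δ/n)` for every `δ ≥ 0`. -/
theorem biLoc_qAntiAt {ρ : Site 4} (hρ : ∀ i : Fin 4, 0 ≤ ρ i ∧ ρ i < n) {δ : ℝ} (hδ : 0 ≤ δ) :
    BiLoc (qAntiAt ρ n κ' u) u u (8 / (n : ℝ) ^ 3 * Real.exp (8 * δ)) (δ / n) := by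
  have hn : (0 : ℝ) < n := Nat.cast_pos.mpr (Nat.pos_of_ne_zero (NeZero.ne n))
  intro x z a b
  rw [qAntiAt_apply]
  by_cases h : blk (n - 1) z = blk (n - 1) x ∧ blk (n - 1) u = blk (n - 1) x
  · have hx : l1 (x - u) ≤ 4 * n := l1_sub_le_of_blk_eq n h.2.symm
    have hz : l1 (z - u) ≤ 4 * n := l1_sub_le_of_blk_eq n (h.1.trans h.2.symm)
    have h1 := abs_qJetAt_le n κ' u hρ (blk (n - 1) x) z
    have h2 := abs_qJetAt_le n κ' u hρ (blk (n - 1) z) x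
    have h3 : δ / n * (l1 (x - u) + l1 (z - u)) ≤ δ / n * (8 * n) := mul_le_mul_of_nonneg_left (by linarith) (div_nonneg hδ hn.le)
    have h4 : δ / n * (8 * n) = 8 * δ := by field_simp
    have hE : Real.exp (-(8 * δ)) ≤ Real.exp (-(δ / n) * (l1 (x - u) + l1 (z - u))) := Real.exp_le_exp.mpr (by linarith)
    calc |qJetAt ρ n κ' u (blk (n - 1) x) z - qJetAt ρ n κ' u (blk (n - 1) z) x|
          ≤ |qJetAt ρ n κ' u (blk (n - 1) x) z| + |qJetAt ρ n κ' u (blk (n - 1) z) x| := abs_sub _ _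
      _ ≤ 4 / (n : ℝ) ^ 3 + 4 / (n : ℝ) ^ 3 := add_le_add h1 h2
      _ = 8 / (n : ℝ) ^ 3 * Real.exp (8 * δ) * Real.exp (-(8 * δ)) := by
          rw [mul_assoc, ← Real.exp_add, add_neg_cancel, Real.exp_zero, mul_one]; ring
      _ ≤ 8 / (n : ℝ) ^ 3 * Real.exp (8 * δ) * Real.exp (-(δ / n) * (l1 (x - u) + l1 (z - u))) :=
          mul_le_mul_of_nonneg_left hE (by positivity)
  · have h' : ¬(blk (n - 1) x = blk (n - 1) z ∧ blk (n - 1) u = blk (n - 1) z) :=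
      fun hh => h ⟨hh.1.symm, hh.2.trans hh.1.symm⟩
    rw [qJetAt_eq_zero ρ n κ' u h, qJetAt_eq_zero ρ n κ' u h', sub_zero, abs_zero]; positivity

/-- [folklore] **LOCALISATION SOCKET OF THE ROOTED STENCIL**: `BiLoc (SghAt ρ n cK cQ κ′ u) u u (|cK|·e^{δ/n} + |cQ|·(8/n³)·e^{8δ}) (δ/n)`. -/
theorem biLoc_SghAt {ρ : Site 4} (hρ : ∀ i : Fin 4, 0 ≤ ρ i ∧ ρ i < n) (cK cQ : ℝ) {δ : ℝ} (hδ : 0 ≤ δ) :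
    BiLoc (SghAt ρ n cK cQ κ' u) u u (|cK| * Real.exp (δ / n) + |cQ| * (8 / (n : ℝ) ^ 3 * Real.exp (8 * δ))) (δ / n) := by
  intro x z a b
  have hg := biLoc_ghCur κ' u (δ / n) x z a b
  have hq := biLoc_qAntiAt n κ' u hρ hδ x z a b
  rw [SghAt_apply]
  calc |cK * ghCur κ' u x z a b + cQ * qAntiAt ρ n κ' u x z a b|
        ≤ |cK * ghCur κ' u x z a b| + |cQ * qAntiAt ρ n κ' u x z a b| := abs_add_le _ _
    _ = |cK| * |ghCur κ' u x z a b| + |cQ| * |qAntiAt ρ n κ' u x z a b| := by rw [abs_mul, abs_mul]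
    _ ≤ |cK| * (Real.exp (δ / n) * Real.exp (-(δ / n) * (l1 (x - u) + l1 (z - u)))) +
        |cQ| * (8 / (n : ℝ) ^ 3 * Real.exp (8 * δ) * Real.exp (-(δ / n) * (l1 (x - u) + l1 (z - u)))) :=
          add_le_add (mul_le_mul_of_nonneg_left hg (abs_nonneg _)) (mul_le_mul_of_nonneg_left hq (abs_nonneg _))
    _ = (|cK| * Real.exp (δ / n) + |cQ| * (8 / (n : ℝ) ^ 3 * Real.exp (8 * δ))) *
        Real.exp (-(δ / n) * (l1 (x - u) + l1 (z - u))) := by ring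

/-! ## §3 Block-translation covariance (any root) -/

/-- [folklore] **BLOCK-TRANSLATION COVARIANCE OF THE ROOTED JET** (the root moves with the block). -/
theorem qJetAt_translate (t y x : Site 4) :
    qJetAt ρ n κ' (u + (n : ℤ) • t) (y + t) (x + (n : ℤ) • t) = qJetAt ρ n κ' u y x := by
  unfold qJetAt
  rw [blk_translate', blk_translate']
  have hr : (n : ℤ) • (y + t) + ρ = ((n : ℤ) • y + ρ) + (n : ℤ) • t := by rw [smul_add]; abel
  simp only [add_left_inj, hr, gammaCoeff_translate]

/-- [folklore] Block-translation covariance of `qAntiAt`, pointwise form. -/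
theorem qAntiAt_translate_apply (t x z : Site 4) (a b : Unit) :
    qAntiAt ρ n κ' (u + (n : ℤ) • t) (x + (n : ℤ) • t) (z + (n : ℤ) • t) a b = qAntiAt ρ n κ' u x z a b := by
  simp only [qAntiAt_apply, blk_translate', qJetAt_translate]

/-- [folklore] **BLOCK-TRANSLATION COVARIANCE** of `qAntiAt` in the `shiftK` form. -/
theorem qAntiAt_translate (t : Site 4) : qAntiAt ρ n κ' (u + (n : ℤ) • t) = shiftK (-((n : ℤ) • t)) (qAntiAt ρ n κ' u) := by
  funext x z a b
  show qAntiAt ρ n κ' (u + (n : ℤ) • t) x z a b = qAntiAt ρ n κ' u (x + -((n : ℤ) • t)) (z + -((n : ℤ) • t)) a b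
  simpa only [neg_add_cancel_right] using qAntiAt_translate_apply ρ n κ' u t (x + -((n : ℤ) • t)) (z + -((n : ℤ) • t)) a b

/-- [folklore] **BLOCK-TRANSLATION COVARIANCE OF THE ROOTED STENCIL**: `SghAt ρ n cK cQ κ′ (u + n•t) = shiftK (−n•t) (SghAt ρ n cK cQ κ′ u)`. -/
theorem SghAt_translate (cK cQ : ℝ) (t : Site 4) :
    SghAt ρ n cK cQ κ' (u + (n : ℤ) • t) = shiftK (-((n : ℤ) • t)) (SghAt ρ n cK cQ κ' u) := by
  funext x z a b
  simp only [SghAt_apply, ghCur_translate, qAntiAt_translate, shiftK]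

/-- [folklore] The same in leaf-04's binder shape (`∀ κ′ u t`). -/
theorem SghAt_translate_block (cK cQ : ℝ) (κ₁ : Fin 4) (v t : Site 4) :
    SghAt ρ n cK cQ κ₁ (v + (n : ℤ) • t) = shiftK (-((n : ℤ) • t)) (SghAt ρ n cK cQ κ₁ v) :=
  SghAt_translate ρ n κ₁ v cK cQ t

end Summit.QuantumFields.BalabanUV.Beta.D1BFx.GhostStencilRooted

end
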